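import Mathlib
import Literature.NumberTheory.Sieve.ParityBarrier

/-!
# The pointwise law from binary-forms Chowla (crux `FanDecorrelation`, line `SketchIdeator5`)

Stub `stub_pointwiseOfBinaryForms` of the crux `FanDecorrelation`
(`Summit.Parity.GeneralizedHardyLittlewood.Theses.LiouvilleMAD`), line `SketchIdeator5`.

Notation (informal; nothing is defined in this file, every statement is written out over Mathlib):
`Q = ⌊√M⌋ + 1 = Nat.sqrt M + 1`, `λ = ArithmeticFunction.liouville` (arguments via `Int.toNat`),
and for a lag `h : ℤ` the lag correlation
`D(h) = Σ_{(m,m') ∈ (M,2M]², m − m' = h} λ(mn+c) λ(m'n'+c)`.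

`stub_pointwiseOfBinaryForms`: the binary-forms Chowla bound (power saving
`|Σ_{u ∈ (X,X+L]} λ(u n₁ + a₁) λ(u n₂ + a₂)| ≤ C X^{1−κ}` for non-proportional pairs of linear forms
with `L ≤ X`, `1 ≤ nᵢ ≤ 2X`, `0 < nᵢ X + aᵢ`, `|aᵢ| ≤ 2 nᵢ X`) implies the POINTWISE law: for every
`c ≠ 0` there are `κ' > 0` and `C'` with `|D(h)| ≤ C' M^{1−κ'}` for all `1 ≤ n ≠ n' ≤ 2M` and every
lag with `2|h| ≥ Q`.

Proof: `κ' = min κ (1/2)`, `C' = max C 0 + (4c²)²`.  If `M < 4c²` the trivial bound `|D(h)| ≤ M²`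
suffices (`M^{1−κ'} ≥ 1`).  If `M ≥ 4c²` then `Q > 2|c|`, so `|h| > |c|`; for `0 < h` the lag graph
`{(m,m') ∈ (M,2M]², m − m' = h}` is `{(u+h, u) : u ∈ (M, 2M−h]}` (empty once `h ≥ M`), and
`λ((u+h)n+c) λ(un'+c)` is the pair of forms `(n, hn+c; n', c)` on `(M, M+(M−h)]`, non-proportional
because `|c(n−n')| < |c|·nn' < h·nn'`; negative lags reduce to positive ones by the swap
`(m,m') ↦ (m',m)`, which exchanges `n` and `n'`.  `|λ| ≤ 1` is the tree's
`Literature.NumberTheory.Sieve.abs_liouville_le_one`.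
-/

namespace Summit.Parity.GeneralizedHardyLittlewood.Theorems.FanDecorrelation.PointwiseOfBinaryForms

/-- Trivial bound `|D(h)| ≤ M²`: at most `M²` pairs, each term of modulus at most `1`. [folklore] -/
theorem abs_lagSum_le (c : ℤ) (n n' M : ℕ) (h : ℤ) :
    |∑ p ∈ (Finset.Ioc M (2 * M) ×ˢ Finset.Ioc M (2 * M)).filter
          (fun p : ℕ × ℕ => (p.1 : ℤ) - p.2 = h),
        (ArithmeticFunction.liouville (Int.toNat ((p.1 : ℤ) * n + c)) : ℝ) *
          (ArithmeticFunction.liouville (Int.toNat ((p.2 : ℤ) * n' + c)) : ℝ)| ≤ (M : ℝ) ^ 2 := by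
  -- adapted from `abs_fanSum_le` in Theorems/LiouvilleMADFanDecorrelationStubFanFromLaws.lean
  refine (Finset.abs_sum_le_sum_abs _ _).trans ?_
  calc ∑ p ∈ (Finset.Ioc M (2 * M) ×ˢ Finset.Ioc M (2 * M)).filter
          (fun p : ℕ × ℕ => (p.1 : ℤ) - p.2 = h),
          |(ArithmeticFunction.liouville (Int.toNat ((p.1 : ℤ) * n + c)) : ℝ) *
            (ArithmeticFunction.liouville (Int.toNat ((p.2 : ℤ) * n' + c)) : ℝ)|
        ≤ ∑ p ∈ (Finset.Ioc M (2 * M) ×ˢ Finset.Ioc M (2 * M)).filter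
            (fun p : ℕ × ℕ => (p.1 : ℤ) - p.2 = h), (1 : ℝ) := by
          refine Finset.sum_le_sum fun p _ => ?_
          rw [abs_mul]
          exact mul_le_one₀ (Literature.NumberTheory.Sieve.abs_liouville_le_one _) (abs_nonneg _)
            (Literature.NumberTheory.Sieve.abs_liouville_le_one _)
    _ ≤ ∑ p ∈ Finset.Ioc M (2 * M) ×ˢ Finset.Ioc M (2 * M), (1 : ℝ) :=
          Finset.sum_le_sum_of_subset_of_nonneg (Finset.filter_subset _ _)
            (fun _ _ _ => zero_le_one)
    _ = (M : ℝ) ^ 2 := by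
          rw [Finset.sum_const, Finset.card_product, Nat.card_Ioc, nsmul_eq_mul, mul_one]
          have : 2 * M - M = M := by omega
          rw [this]; push_cast; ring

/-- The lag graph at a lag `t ≥ 0`: the pairs `(m,m') ∈ (M,2M]²` with `m − m' = t` are exactly the
`(u + t, u)` with `u ∈ (M, M + (M − t)]` (empty once `t ≥ M`). [folklore] -/
theorem filter_lag_eq_map (M t : ℕ) :
    (Finset.Ioc M (2 * M) ×ˢ Finset.Ioc M (2 * M)).filter
        (fun p : ℕ × ℕ => (p.1 : ℤ) - p.2 = (t : ℤ)) =
      (Finset.Ioc M (M + (M - t))).map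
        ⟨fun u : ℕ => (u + t, u), fun u v huv => by simpa using congrArg Prod.snd huv⟩ := by
  ext ⟨a, b⟩
  simp only [Finset.mem_filter, Finset.mem_product, Finset.mem_Ioc, Finset.mem_map,
    Function.Embedding.coeFn_mk, Prod.mk.injEq]
  constructor
  · rintro ⟨⟨⟨_, ha2⟩, hb1, _⟩, hab⟩
    exact ⟨b, ⟨hb1, by omega⟩, by omega, rfl⟩
  · rintro ⟨u, ⟨hu1, hu2⟩, rfl, rfl⟩
    exact ⟨⟨⟨by omega, by omega⟩, by omega, by omega⟩, by omega⟩

/-- Negative lags are swapped positive lags: `D_{n,n'}(−h) = D_{n',n}(h)` via `(m,m') ↦ (m',m)`.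
[folklore] -/
theorem lagSum_neg (c : ℤ) (n n' M : ℕ) (h : ℤ) :
    ∑ p ∈ (Finset.Ioc M (2 * M) ×ˢ Finset.Ioc M (2 * M)).filter
          (fun p : ℕ × ℕ => (p.1 : ℤ) - p.2 = -h),
        (ArithmeticFunction.liouville (Int.toNat ((p.1 : ℤ) * n + c)) : ℝ) *
          (ArithmeticFunction.liouville (Int.toNat ((p.2 : ℤ) * n' + c)) : ℝ) =
      ∑ p ∈ (Finset.Ioc M (2 * M) ×ˢ Finset.Ioc M (2 * M)).filter
          (fun p : ℕ × ℕ => (p.1 : ℤ) - p.2 = h),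
        (ArithmeticFunction.liouville (Int.toNat ((p.1 : ℤ) * n' + c)) : ℝ) *
          (ArithmeticFunction.liouville (Int.toNat ((p.2 : ℤ) * n + c)) : ℝ) := by
  -- adapted from `fanSum_neg` in Theorems/LiouvilleMADFanDecorrelationStubFanFromLaws.lean
  refine Finset.sum_nbij' Prod.swap Prod.swap ?_ ?_ (fun _ _ => rfl) (fun _ _ => rfl) ?_
  · intro p hp
    rw [Finset.mem_filter, Finset.mem_product] at hp ⊢
    refine ⟨⟨hp.1.2, hp.1.1⟩, ?_⟩
    simp only [Prod.fst_swap, Prod.snd_swap]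
    linarith [hp.2]
  · intro p hp
    rw [Finset.mem_filter, Finset.mem_product] at hp ⊢
    refine ⟨⟨hp.1.2, hp.1.1⟩, ?_⟩
    simp only [Prod.fst_swap, Prod.snd_swap]
    linarith [hp.2]
  · intro p _
    simp only [Prod.fst_swap, Prod.snd_swap]
    ring

/-- No proportional pair at a large lag: if `1 ≤ n`, `1 ≤ n'` and `|c| < t` then
`n·c ≠ n'·(t n + c)`, i.e. `c(n − n') ≠ t n n'`, because `|c(n−n')| ≤ |c|·nn' < t·nn'`.
[folklore] -/
theorem natCast_mul_ne_of_abs_lt {c : ℤ} {n n' t : ℕ} (hn : 1 ≤ n) (hn' : 1 ≤ n')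
    (hct : |c| < (t : ℤ)) : (n : ℤ) * c ≠ (n' : ℤ) * ((t : ℤ) * n + c) := by
  intro h
  have hnZ : (1 : ℤ) ≤ n := by exact_mod_cast hn
  have hn'Z : (1 : ℤ) ≤ n' := by exact_mod_cast hn'
  have h1 : c * ((n : ℤ) - n') = (t : ℤ) * n * n' := by linear_combination h
  have h2 : |(n : ℤ) - n'| ≤ (n : ℤ) * n' := by
    rcases le_or_gt (n' : ℤ) n with hle | hlt
    · rw [abs_of_nonneg (by linarith)]
      nlinarith
    · rw [abs_of_neg (by linarith)]
      nlinarith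
  have h3 : |c * ((n : ℤ) - n')| < |(t : ℤ) * n * n'| := by
    rw [abs_mul, abs_of_nonneg (by positivity : (0 : ℤ) ≤ (t : ℤ) * n * n')]
    calc |c| * |(n : ℤ) - n'| ≤ |c| * ((n : ℤ) * n') :=
          mul_le_mul_of_nonneg_left h2 (abs_nonneg c)
      _ < (t : ℤ) * ((n : ℤ) * n') := mul_lt_mul_of_pos_right hct (by positivity)
      _ = (t : ℤ) * n * n' := by ring
  rw [h1] at h3
  exact lt_irrefl _ h3

/-- The positive-lag case: from the binary-forms Chowla bound (constants `κ`, `C`), for every lag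
`t > |c|` and `1 ≤ n, n' ≤ 2M` one has `|D(t)| ≤ max C 0 · M^{1−κ}`.  For `t ≥ M` the lag graph is
empty; for `t < M` it is `{(u+t,u) : u ∈ (M, M+(M−t)]}` and the bound is the hypothesis for the pair
of forms `(n, t n + c; n', c)` with `X = M`, `L = M − t`. [folklore] -/
theorem abs_lagSum_le_of_binaryForms {κ C : ℝ}
    (hC : ∀ X L n₁ n₂ : ℕ, ∀ a₁ a₂ : ℤ,
      L ≤ X → 1 ≤ n₁ → 1 ≤ n₂ → n₁ ≤ 2 * X → n₂ ≤ 2 * X →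
        0 < (n₁ : ℤ) * X + a₁ → 0 < (n₂ : ℤ) * X + a₂ →
          |a₁| ≤ 2 * (n₁ : ℤ) * X → |a₂| ≤ 2 * (n₂ : ℤ) * X →
            (n₁ : ℤ) * a₂ ≠ (n₂ : ℤ) * a₁ →
              |∑ u ∈ Finset.Ioc X (X + L),
                  (ArithmeticFunction.liouville (Int.toNat ((u : ℤ) * n₁ + a₁)) : ℝ) *
                    (ArithmeticFunction.liouville (Int.toNat ((u : ℤ) * n₂ + a₂)) : ℝ)| ≤
                C * (X : ℝ) ^ (1 - κ))
    (c : ℤ) (M n n' t : ℕ) (hn : 1 ≤ n) (hn' : 1 ≤ n') (hnM : n ≤ 2 * M) (hn'M : n' ≤ 2 * M)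
    (hct : |c| < (t : ℤ)) :
    |∑ p ∈ (Finset.Ioc M (2 * M) ×ˢ Finset.Ioc M (2 * M)).filter
          (fun p : ℕ × ℕ => (p.1 : ℤ) - p.2 = (t : ℤ)),
        (ArithmeticFunction.liouville (Int.toNat ((p.1 : ℤ) * n + c)) : ℝ) *
          (ArithmeticFunction.liouville (Int.toNat ((p.2 : ℤ) * n' + c)) : ℝ)| ≤
      max C 0 * (M : ℝ) ^ (1 - κ) := by
  have hM0 : (0 : ℝ) ≤ (M : ℝ) := by positivity
  have hCn : 0 ≤ max C 0 * (M : ℝ) ^ (1 - κ) :=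
    mul_nonneg (le_max_right _ _) (Real.rpow_nonneg hM0 _)
  rw [filter_lag_eq_map, Finset.sum_map]
  simp only [Function.Embedding.coeFn_mk]
  rcases le_or_gt M t with hMt | htM
  · -- `t ≥ M`: the lag graph is empty
    have hE : M + (M - t) = M := by omega
    rw [hE, Finset.Ioc_self, Finset.sum_empty, abs_zero]
    exact hCn
  · -- `t < M`: the hypothesis for the pair `(n, t n + c; n', c)` on `(M, M + (M - t)]`
    have htZ : (t : ℤ) + 1 ≤ (M : ℤ) := by exact_mod_cast htM
    have hnZ : (1 : ℤ) ≤ n := by exact_mod_cast hn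
    have hn'Z : (1 : ℤ) ≤ n' := by exact_mod_cast hn'
    have e1 : (M : ℤ) ≤ (n : ℤ) * M := le_mul_of_one_le_left (by positivity) hnZ
    have e1' : (M : ℤ) ≤ (n' : ℤ) * M := le_mul_of_one_le_left (by positivity) hn'Z
    have e2 : (0 : ℤ) ≤ (t : ℤ) * n := by positivity
    have e3 : -|c| ≤ c := neg_abs_le c
    have e4 : c ≤ |c| := le_abs_self c
    have e5 : (t : ℤ) * n ≤ ((M : ℤ) - 1) * n :=
      mul_le_mul_of_nonneg_right (by linarith) (by positivity)
    have e6 : (0 : ℤ) ≤ (n' : ℤ) * M := by positivity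
    have h1 : 0 < (n : ℤ) * M + ((t : ℤ) * n + c) := by linarith
    have h2 : 0 < (n' : ℤ) * M + c := by linarith
    have h3 : |(t : ℤ) * n + c| ≤ 2 * (n : ℤ) * M := by
      rw [abs_le]
      constructor
      · nlinarith
      · nlinarith
    have h4 : |c| ≤ 2 * (n' : ℤ) * M := by linarith
    have h5 : (n : ℤ) * c ≠ (n' : ℤ) * ((t : ℤ) * n + c) := natCast_mul_ne_of_abs_lt hn hn' hct
    have key := hC M (M - t) n n' ((t : ℤ) * n + c) c (Nat.sub_le M t) hn hn' hnM hn'M h1 h2 h3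
      h4 h5
    have harg : ∀ u : ℕ, ((u + t : ℕ) : ℤ) * n + c = (u : ℤ) * n + ((t : ℤ) * n + c) := by
      intro u; push_cast; ring
    calc |∑ u ∈ Finset.Ioc M (M + (M - t)),
            (ArithmeticFunction.liouville (Int.toNat (((u + t : ℕ) : ℤ) * n + c)) : ℝ) *
              (ArithmeticFunction.liouville (Int.toNat ((u : ℤ) * n' + c)) : ℝ)|
        = |∑ u ∈ Finset.Ioc M (M + (M - t)),
            (ArithmeticFunction.liouville (Int.toNat ((u : ℤ) * n + ((t : ℤ) * n + c))) : ℝ) *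
              (ArithmeticFunction.liouville (Int.toNat ((u : ℤ) * n' + c)) : ℝ)| := by
          congr 1
          refine Finset.sum_congr rfl fun u _ => ?_
          rw [harg u]
      _ ≤ C * (M : ℝ) ^ (1 - κ) := key
      _ ≤ max C 0 * (M : ℝ) ^ (1 - κ) :=
          mul_le_mul_of_nonneg_right (le_max_left _ _) (Real.rpow_nonneg hM0 _)

/-- **The pointwise law from binary-forms Chowla** (stub `stub_pointwiseOfBinaryForms` of line
`SketchIdeator5` of the crux `FanDecorrelation`).  Hypothesis: power-saving Chowla for two
non-proportional linear forms `u ↦ u n₁ + a₁`, `u ↦ u n₂ + a₂` on `(X, X+L] ⊆ (X, 2X]`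
(`1 ≤ nᵢ ≤ 2X`, `0 < nᵢ X + aᵢ`, `|aᵢ| ≤ 2 nᵢ X`, `n₁ a₂ ≠ n₂ a₁`): `|Σ_u λ(u n₁+a₁) λ(u n₂+a₂)| ≤ C X^{1−κ}`.
Conclusion: for every `c ≠ 0` there are `κ' > 0`, `C'` with
`|Σ_{(m,m') ∈ (M,2M]², m−m'=h} λ(mn+c) λ(m'n'+c)| ≤ C' M^{1−κ'}` for all `1 ≤ n ≠ n' ≤ 2M` and every
lag `h` with `2|h| ≥ ⌊√M⌋ + 1`.  Choice: `κ' = min κ (1/2)`, `C' = max C 0 + (4c²)²`; `M < 4c²` by the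
trivial bound `M²`, `M ≥ 4c²` forces `|h| > |c|` and the lag graph is a segment of the pair of forms
`(n, hn+c; n', c)` (`h > 0`; `h < 0` by the swap `(m,m') ↦ (m',m)`). [folklore] -/
theorem stub_pointwiseOfBinaryForms :
    (∃ κ : ℝ, 0 < κ ∧ ∃ C : ℝ, ∀ X L n₁ n₂ : ℕ, ∀ a₁ a₂ : ℤ,
      L ≤ X → 1 ≤ n₁ → 1 ≤ n₂ → n₁ ≤ 2 * X → n₂ ≤ 2 * X →
        0 < (n₁ : ℤ) * X + a₁ → 0 < (n₂ : ℤ) * X + a₂ →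
          |a₁| ≤ 2 * (n₁ : ℤ) * X → |a₂| ≤ 2 * (n₂ : ℤ) * X →
            (n₁ : ℤ) * a₂ ≠ (n₂ : ℤ) * a₁ →
              |∑ u ∈ Finset.Ioc X (X + L),
                  (ArithmeticFunction.liouville (Int.toNat ((u : ℤ) * n₁ + a₁)) : ℝ) *
                    (ArithmeticFunction.liouville (Int.toNat ((u : ℤ) * n₂ + a₂)) : ℝ)| ≤
                C * (X : ℝ) ^ (1 - κ)) →
    ∀ c : ℤ, c ≠ 0 → ∃ κ : ℝ, 0 < κ ∧ ∃ C : ℝ, ∀ M n n' : ℕ, ∀ h : ℤ,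
      1 ≤ n → 1 ≤ n' → n ≠ n' → n ≤ 2 * M → n' ≤ 2 * M →
        (Nat.sqrt M : ℤ) + 1 ≤ 2 * |h| →
          |∑ p ∈ (Finset.Ioc M (2 * M) ×ˢ Finset.Ioc M (2 * M)).filter
                (fun p : ℕ × ℕ => (p.1 : ℤ) - p.2 = h),
              (ArithmeticFunction.liouville (Int.toNat ((p.1 : ℤ) * n + c)) : ℝ) *
                (ArithmeticFunction.liouville (Int.toNat ((p.2 : ℤ) * n' + c)) : ℝ)| ≤
            C * (M : ℝ) ^ (1 - κ) := by
  rintro ⟨κ, hκ, C, hC⟩ c _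
  refine ⟨min κ (1 / 2), lt_min hκ (by norm_num), max C 0 + (4 * (c : ℝ) ^ 2) ^ 2, ?_⟩
  intro M n n' h hn hn' _ hnM hn'M hh
  have hM1 : (1 : ℝ) ≤ (M : ℝ) := by exact_mod_cast (show 1 ≤ M by omega)
  have hM0 : (0 : ℝ) ≤ (M : ℝ) := by positivity
  have hC0 : 0 ≤ max C 0 := le_max_right _ _
  have hC'0 : 0 ≤ max C 0 + (4 * (c : ℝ) ^ 2) ^ 2 := by positivity
  have hpow1 : 1 ≤ (M : ℝ) ^ (1 - min κ (1 / 2)) :=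
    Real.one_le_rpow hM1 (by have := min_le_right κ (1 / 2); linarith)
  have hpowκ : (M : ℝ) ^ (1 - κ) ≤ (M : ℝ) ^ (1 - min κ (1 / 2)) :=
    Real.rpow_le_rpow_of_exponent_le hM1 (by have := min_le_left κ (1 / 2); linarith)
  by_cases hbig : 4 * c ^ 2 ≤ (M : ℤ)
  · -- `M ≥ 4c²`: `Q > 2|c|`, so `|h| > |c|`, and the positive-lag case applies (after a swap)
    have hch : |c| < |h| := by
      have hA : |c| * |c| = c * c := abs_mul_abs_self c
      have h' : ((2 * c.natAbs * (2 * c.natAbs) : ℕ) : ℤ) ≤ (M : ℤ) := by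
        push_cast
        nlinarith [hA, hbig]
      have h1 : 2 * c.natAbs ≤ Nat.sqrt M := Nat.le_sqrt.2 (by exact_mod_cast h')
      have h2 : ((c.natAbs : ℕ) : ℤ) = |c| := Int.natCast_natAbs c
      have h3 : 2 * ((c.natAbs : ℕ) : ℤ) ≤ (Nat.sqrt M : ℤ) := by exact_mod_cast h1
      rw [h2] at h3
      linarith
    have hbound : |∑ p ∈ (Finset.Ioc M (2 * M) ×ˢ Finset.Ioc M (2 * M)).filter
            (fun p : ℕ × ℕ => (p.1 : ℤ) - p.2 = h),
          (ArithmeticFunction.liouville (Int.toNat ((p.1 : ℤ) * n + c)) : ℝ) *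
            (ArithmeticFunction.liouville (Int.toNat ((p.2 : ℤ) * n' + c)) : ℝ)| ≤
        max C 0 * (M : ℝ) ^ (1 - κ) := by
      rcases le_or_gt 0 h with hpos | hneg
      · obtain ⟨t, rfl⟩ : ∃ t : ℕ, h = (t : ℤ) := ⟨h.natAbs, by omega⟩
        rw [Nat.abs_cast] at hch
        exact abs_lagSum_le_of_binaryForms hC c M n n' t hn hn' hnM hn'M hch
      · obtain ⟨t, rfl⟩ : ∃ t : ℕ, h = -(t : ℤ) := ⟨h.natAbs, by omega⟩
        rw [abs_neg, Nat.abs_cast] at hch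
        rw [lagSum_neg c n n' M (t : ℤ)]
        exact abs_lagSum_le_of_binaryForms hC c M n' n t hn' hn hn'M hnM hch
    calc _ ≤ max C 0 * (M : ℝ) ^ (1 - κ) := hbound
      _ ≤ max C 0 * (M : ℝ) ^ (1 - min κ (1 / 2)) := mul_le_mul_of_nonneg_left hpowκ hC0
      _ ≤ (max C 0 + (4 * (c : ℝ) ^ 2) ^ 2) * (M : ℝ) ^ (1 - min κ (1 / 2)) :=
          mul_le_mul_of_nonneg_right (le_add_of_nonneg_right (by positivity))
            (Real.rpow_nonneg hM0 _)
  · -- `M < 4c²`: the trivial bound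
    push Not at hbig
    have hMc : (M : ℝ) ≤ 4 * (c : ℝ) ^ 2 := by exact_mod_cast hbig.le
    calc _ ≤ (M : ℝ) ^ 2 := abs_lagSum_le c n n' M h
      _ ≤ (4 * (c : ℝ) ^ 2) ^ 2 := pow_le_pow_left₀ hM0 hMc 2
      _ ≤ max C 0 + (4 * (c : ℝ) ^ 2) ^ 2 := le_add_of_nonneg_left hC0
      _ ≤ (max C 0 + (4 * (c : ℝ) ^ 2) ^ 2) * (M : ℝ) ^ (1 - min κ (1 / 2)) :=
          le_mul_of_one_le_right hC'0 hpow1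

end Summit.Parity.GeneralizedHardyLittlewood.Theorems.FanDecorrelation.PointwiseOfBinaryForms
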